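import Summits.CriticalPhenomena.PercolationContinuityZ3.Theorems.PercNearOneGluingAdditiveGluingKnThm2GoodEvents
import HarnessLib

/-! # Crux `PercNearOneGluing.AdditiveGluing` (stmt-CriticalPhenomena-4576): three relays — set identities for the glued pair
# `W = {a₁,a₃}` (events of `G/W` written in `G`)

Support file (`--supports stmt-CriticalPhenomena-4576`, lead prim-png-lead-4576).  No definitions, no named facts, no sorries.
Notation: relays `a₁ a₂ a₃`, target `b`, observer `o`; `W = {a₁,a₃}`; `N₂ = {a₂↮a₁}∩{a₂↮a₃}`, `O_W = {o↔a₁}∪{o↔a₃}`,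
`O₂ = {o↔a₂}`, `OA = {o↔a₁}∪{o↔a₂}∪{o↔a₃}`, `B_W = {a₁↔b}∪{a₃↔b}`, `P' = ({o↔a₁}∩{a₃↔b}) ∪ ({o↔a₃}∩{a₁↔b})`,
`Q' = ({a₂↔a₁}∩{a₃↔b}) ∪ ({a₂↔a₃}∩{a₁↔b})`.  In the glued graph `G/W` (the pair `W` identified to one vertex `w`):
`{o ↔' b} = {o↔b} ∪ P'`, `{a₂ ↔' b} = {a₂↔b} ∪ Q'`, `{o ↔' w} = O_W`, `{o ↔' a₂} = O₂ ∪ (O_W ∩ ({a₂↔a₁}∪{a₂↔a₃}))`,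
`{w ↮' a₂} = N₂`.  The lemmas below are the pointwise facts behind Kozma–Nitzan's "subtract the common event" step of
Theorem 1 for the relay pair `{w, a₂}` of `G/W` (used in `PercNearOneGluingAdditiveGluingGluedPairReduction`).
[cite: KozmaNitzan2024, Theorem 1 (§3.1, pp. 7–8)]
-/

namespace Summit.CriticalPhenomena.PercolationContinuityZ3.Theorems

open MeasureTheory Set Literature.Probability.LatticeModels Literature.Probability.Percolation

noncomputable section
open Classical

variable {n : ℕ}

section SetIdentities
variable (o b a₁ a₂ a₃ : Fin n)

/-- `(a₃↔b)ᶜ` splits as `B_Wᶜ ⊔ (a₁↔b ∖ a₃↔b)`. [folklore] -/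
theorem gluedPair_compl3_eq :
    ((openConn a₃ b)ᶜ : Set (BondConfig (Fin n))) =
      (openConn a₁ b ∪ openConn a₃ b)ᶜ ∪ (openConn a₁ b ∩ (openConn a₃ b)ᶜ) := by
  ext ω; simp only [Set.mem_compl_iff, Set.mem_union, Set.mem_inter_iff]; tauto

/-- The two pieces of `gluedPair_compl3_eq` are disjoint. [folklore] -/
theorem gluedPair_compl3_disj :
    Disjoint ((openConn a₁ b ∪ openConn a₃ b)ᶜ : Set (BondConfig (Fin n))) (openConn a₁ b ∩ (openConn a₃ b)ᶜ) := by
  rw [Set.disjoint_left]; intro ω h1 h2; exact h1 (Or.inl h2.1)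

/-- On `O_W = {o↔a₁}∪{o↔a₃}`, "`o↔b` or `o`,`b` hold the two relays of `W`" is the same as `B_W`. [folklore] -/
theorem gluedPair_OW_E_eq :
    ((openConn o a₁ ∪ openConn o a₃) ∩ (openConn o b ∪ (openConn o a₁ ∩ openConn a₃ b ∪ openConn o a₃ ∩ openConn a₁ b)) :
        Set (BondConfig (Fin n))) =
      (openConn o a₁ ∪ openConn o a₃) ∩ (openConn a₁ b ∪ openConn a₃ b) := by
  ext ω
  simp only [Set.mem_inter_iff, Set.mem_union, knThm2_mem_openConn]
  constructor
  · rintro ⟨hW, hE⟩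
    refine ⟨hW, ?_⟩
    rcases hE with hob | ⟨-, h3⟩ | ⟨-, h1⟩
    · rcases hW with h | h
      · exact Or.inl (h.symm.trans hob)
      · exact Or.inr (h.symm.trans hob)
    · exact Or.inr h3
    · exact Or.inl h1
  · rintro ⟨hW, hB⟩
    refine ⟨hW, ?_⟩
    rcases hW with ho1 | ho3
    · rcases hB with h1 | h3
      · exact Or.inl (ho1.trans h1)
      · exact Or.inr (Or.inl ⟨ho1, h3⟩)
    · rcases hB with h1 | h3
      · exact Or.inr (Or.inr ⟨ho3, h1⟩)
      · exact Or.inl (ho3.trans h3)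

/-- `{o↔a₂} ∖ O_W = N₂ ∩ {o↔a₂}`. [folklore] -/
theorem gluedPair_O2_diff_OW :
    ((openConn o a₂) ∩ (openConn o a₁ ∪ openConn o a₃)ᶜ : Set (BondConfig (Fin n))) =
      (openConn a₂ a₁)ᶜ ∩ (openConn a₂ a₃)ᶜ ∩ openConn o a₂ := by
  ext ω
  simp only [Set.mem_inter_iff, Set.mem_compl_iff, Set.mem_union, knThm2_mem_openConn, not_or]
  constructor
  · rintro ⟨h2, hn1, hn3⟩
    exact ⟨⟨fun h => hn1 (h2.trans h), fun h => hn3 (h2.trans h)⟩, h2⟩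
  · rintro ⟨⟨hn1, hn3⟩, h2⟩
    exact ⟨h2, fun h => hn1 (h2.symm.trans h), fun h => hn3 (h2.symm.trans h)⟩

/-- On `N₂ ∩ {o↔a₂}`: `o↔b ∨ P'` is `a₂↔b`. [folklore] -/
theorem gluedPair_O2N2_E_eq :
    ((openConn a₂ a₁)ᶜ ∩ (openConn a₂ a₃)ᶜ ∩ openConn o a₂ ∩
        (openConn o b ∪ (openConn o a₁ ∩ openConn a₃ b ∪ openConn o a₃ ∩ openConn a₁ b)) : Set (BondConfig (Fin n))) =
      (openConn a₂ a₁)ᶜ ∩ (openConn a₂ a₃)ᶜ ∩ openConn o a₂ ∩ openConn a₂ b := by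
  ext ω
  simp only [Set.mem_inter_iff, Set.mem_compl_iff, Set.mem_union, knThm2_mem_openConn]
  constructor
  · rintro ⟨⟨⟨hn1, hn3⟩, h2⟩, hE⟩
    refine ⟨⟨⟨hn1, hn3⟩, h2⟩, ?_⟩
    rcases hE with hob | ⟨ho1, -⟩ | ⟨ho3, -⟩
    · exact h2.symm.trans hob
    · exact absurd (h2.symm.trans ho1) hn1
    · exact absurd (h2.symm.trans ho3) hn3
  · rintro ⟨⟨⟨hn1, hn3⟩, h2⟩, hb⟩
    exact ⟨⟨⟨hn1, hn3⟩, h2⟩, Or.inl (h2.trans hb)⟩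

/-- `OA = O_W ⊔ (O₂ ∖ O_W)`. [folklore] -/
theorem gluedPair_OA_eq :
    ((openConn o a₁ ∪ openConn o a₂ ∪ openConn o a₃) : Set (BondConfig (Fin n))) =
      (openConn o a₁ ∪ openConn o a₃) ∪ (openConn o a₂ ∩ (openConn o a₁ ∪ openConn o a₃)ᶜ) := by
  ext ω; simp only [Set.mem_union, Set.mem_inter_iff, Set.mem_compl_iff]; tauto

/-- The two pieces of `gluedPair_OA_eq` are disjoint. [folklore] -/
theorem gluedPair_OA_disj :
    Disjoint ((openConn o a₁ ∪ openConn o a₃) : Set (BondConfig (Fin n)))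
      (openConn o a₂ ∩ (openConn o a₁ ∪ openConn o a₃)ᶜ) := by
  rw [Set.disjoint_left]; intro ω h1 h2; exact h2.2 h1

/-- `P = {o↮b} ∩ P' ⊆ OA ∖ {o↔b}` and the complement inside: `OA ∖ {o↔b} = (OA ∖ ({o↔b} ∪ P')) ⊔ ({o↮b} ∩ P')`. [folklore] -/
theorem gluedPair_OAob_eq :
    ((openConn o a₁ ∪ openConn o a₂ ∪ openConn o a₃) \ openConn o b : Set (BondConfig (Fin n))) =
      ((openConn o a₁ ∪ openConn o a₂ ∪ openConn o a₃) \
          (openConn o b ∪ (openConn o a₁ ∩ openConn a₃ b ∪ openConn o a₃ ∩ openConn a₁ b))) ∪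
        ((openConn o b)ᶜ ∩ (openConn o a₁ ∩ openConn a₃ b ∪ openConn o a₃ ∩ openConn a₁ b)) := by
  ext ω; simp only [Set.mem_sdiff, Set.mem_union, Set.mem_inter_iff, Set.mem_compl_iff]; tauto

/-- The two pieces of `gluedPair_OAob_eq` are disjoint. [folklore] -/
theorem gluedPair_OAob_disj :
    Disjoint ((openConn o a₁ ∪ openConn o a₂ ∪ openConn o a₃) \
          (openConn o b ∪ (openConn o a₁ ∩ openConn a₃ b ∪ openConn o a₃ ∩ openConn a₁ b)) : Set (BondConfig (Fin n)))
      ((openConn o b)ᶜ ∩ (openConn o a₁ ∩ openConn a₃ b ∪ openConn o a₃ ∩ openConn a₁ b)) := by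
  rw [Set.disjoint_left]; intro ω h1 h2; exact h1.2 (Or.inr h2.2)

/-- On `O_W ∩ N₂` the glued `a₂↔b`-event `a₂b ∪ Q'` is just `a₂↔b`, and `o↔b ∨ P'` is `B_W`. [folklore] -/
theorem gluedPair_OWN2_F2_eq :
    ((openConn a₂ a₁)ᶜ ∩ (openConn a₂ a₃)ᶜ ∩ (openConn o a₁ ∪ openConn o a₃) ∩
        (openConn a₂ b ∪ (openConn a₂ a₁ ∩ openConn a₃ b ∪ openConn a₂ a₃ ∩ openConn a₁ b)) : Set (BondConfig (Fin n))) =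
      (openConn a₂ a₁)ᶜ ∩ (openConn a₂ a₃)ᶜ ∩ (openConn o a₁ ∪ openConn o a₃) ∩ openConn a₂ b := by
  ext ω
  simp only [Set.mem_inter_iff, Set.mem_compl_iff, Set.mem_union, knThm2_mem_openConn]
  constructor
  · rintro ⟨⟨⟨hn1, hn3⟩, hW⟩, hF⟩
    refine ⟨⟨⟨hn1, hn3⟩, hW⟩, ?_⟩
    rcases hF with hb | ⟨h21, -⟩ | ⟨h23, -⟩
    · exact hb
    · exact absurd h21 hn1
    · exact absurd h23 hn3
  · rintro ⟨h, hb⟩; exact ⟨h, Or.inl hb⟩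

/-- On `O_W ∩ N₂` the glued `o↔b`-event `ob ∪ P'` is `B_W`. [folklore] -/
theorem gluedPair_OWN2_E_eq :
    ((openConn a₂ a₁)ᶜ ∩ (openConn a₂ a₃)ᶜ ∩ (openConn o a₁ ∪ openConn o a₃) ∩
        (openConn o b ∪ (openConn o a₁ ∩ openConn a₃ b ∪ openConn o a₃ ∩ openConn a₁ b)) : Set (BondConfig (Fin n))) =
      (openConn a₂ a₁)ᶜ ∩ (openConn a₂ a₃)ᶜ ∩ (openConn o a₁ ∪ openConn o a₃) ∩ (openConn a₁ b ∪ openConn a₃ b) := by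
  have h := gluedPair_OW_E_eq o b a₁ a₃
  ext ω
  have hω := Set.ext_iff.1 h ω
  simp only [Set.mem_inter_iff, Set.mem_union, Set.mem_compl_iff] at hω ⊢
  constructor
  · rintro ⟨⟨hN, hW⟩, hE⟩; exact ⟨⟨hN, hW⟩, (hω.1 ⟨hW, hE⟩).2⟩
  · rintro ⟨⟨hN, hW⟩, hB⟩; exact ⟨⟨hN, hW⟩, (hω.2 ⟨hW, hB⟩).2⟩

/-- The glued `o↔a₂`-event: `O₂' = O₂ ∪ (O_W ∩ W2)`; on it the glued `o↔b` and `a₂↔b` events coincide: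
`O₂' ∩ (ob ∪ P') = O₂' ∩ (a₂b ∪ Q')`. [folklore] -/
theorem gluedPair_O2glued_eq :
    ((openConn o a₂ ∪ (openConn o a₁ ∪ openConn o a₃) ∩ (openConn a₂ a₁ ∪ openConn a₂ a₃)) ∩
        (openConn o b ∪ (openConn o a₁ ∩ openConn a₃ b ∪ openConn o a₃ ∩ openConn a₁ b)) : Set (BondConfig (Fin n))) =
      (openConn o a₂ ∪ (openConn o a₁ ∪ openConn o a₃) ∩ (openConn a₂ a₁ ∪ openConn a₂ a₃)) ∩
        (openConn a₂ b ∪ (openConn a₂ a₁ ∩ openConn a₃ b ∪ openConn a₂ a₃ ∩ openConn a₁ b)) := by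
  ext ω
  simp only [Set.mem_inter_iff, Set.mem_union, knThm2_mem_openConn]
  constructor
  · rintro ⟨hO, hE⟩
    refine ⟨hO, ?_⟩
    -- `o ~' a₂`: a chain from `a₂` to `o` possibly through a relay of `W`
    rcases hO with h2 | ⟨hW, h2W⟩
    · rcases hE with hob | ⟨ho1, h3⟩ | ⟨ho3, h1⟩
      · exact Or.inl (h2.symm.trans hob)
      · exact Or.inr (Or.inl ⟨h2.symm.trans ho1, h3⟩)
      · exact Or.inr (Or.inr ⟨h2.symm.trans ho3, h1⟩)
    · rcases hE with hob | ⟨ho1, h3⟩ | ⟨ho3, h1⟩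
      · rcases h2W with h21 | h23
        · rcases hW with ho1 | ho3
          · exact Or.inl (h21.trans (ho1.symm.trans hob))
          · exact Or.inr (Or.inl ⟨h21, ho3.symm.trans hob⟩)
        · rcases hW with ho1 | ho3
          · exact Or.inr (Or.inr ⟨h23, ho1.symm.trans hob⟩)
          · exact Or.inl (h23.trans (ho3.symm.trans hob))
      · rcases h2W with h21 | h23
        · exact Or.inr (Or.inl ⟨h21, h3⟩)
        · exact Or.inl (h23.trans h3)
      · rcases h2W with h21 | h23
        · exact Or.inl (h21.trans h1)
        · exact Or.inr (Or.inr ⟨h23, h1⟩)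
  · rintro ⟨hO, hF⟩
    refine ⟨hO, ?_⟩
    rcases hO with h2 | ⟨hW, h2W⟩
    · rcases hF with hb | ⟨h21, h3⟩ | ⟨h23, h1⟩
      · exact Or.inl (h2.trans hb)
      · exact Or.inr (Or.inl ⟨h2.trans h21, h3⟩)
      · exact Or.inr (Or.inr ⟨h2.trans h23, h1⟩)
    · rcases hW with ho1 | ho3
      · rcases hF with hb | ⟨h21, h3⟩ | ⟨h23, h1⟩
        · rcases h2W with h21 | h23
          · exact Or.inl (ho1.trans (h21.symm.trans hb))
          · exact Or.inr (Or.inl ⟨ho1, h23.symm.trans hb⟩)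
        · exact Or.inr (Or.inl ⟨ho1, h3⟩)
        · exact Or.inl (ho1.trans h1)
      · rcases hF with hb | ⟨h21, h3⟩ | ⟨h23, h1⟩
        · rcases h2W with h21 | h23
          · exact Or.inr (Or.inr ⟨ho3, h21.symm.trans hb⟩)
          · exact Or.inl (ho3.trans (h23.symm.trans hb))
        · exact Or.inl (ho3.trans h3)
        · exact Or.inr (Or.inr ⟨ho3, h1⟩)

/-- `OA = O₂' ⊔ (N₂ ∩ O_W)`. [folklore] -/
theorem gluedPair_OA_eq' :
    ((openConn o a₁ ∪ openConn o a₂ ∪ openConn o a₃) : Set (BondConfig (Fin n))) =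
      (openConn o a₂ ∪ (openConn o a₁ ∪ openConn o a₃) ∩ (openConn a₂ a₁ ∪ openConn a₂ a₃)) ∪
        ((openConn a₂ a₁)ᶜ ∩ (openConn a₂ a₃)ᶜ ∩ (openConn o a₁ ∪ openConn o a₃)) := by
  ext ω; simp only [Set.mem_union, Set.mem_inter_iff, Set.mem_compl_iff]; tauto

/-- The two pieces of `gluedPair_OA_eq'` are disjoint. [folklore] -/
theorem gluedPair_OA_disj' :
    Disjoint ((openConn o a₂ ∪ (openConn o a₁ ∪ openConn o a₃) ∩ (openConn a₂ a₁ ∪ openConn a₂ a₃)) : Set (BondConfig (Fin n)))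
      ((openConn a₂ a₁)ᶜ ∩ (openConn a₂ a₃)ᶜ ∩ (openConn o a₁ ∪ openConn o a₃)) := by
  rw [Set.disjoint_left]
  rintro ω h1 ⟨⟨hn1, hn3⟩, hW⟩
  simp only [Set.mem_union, Set.mem_inter_iff, knThm2_mem_openConn, Set.mem_compl_iff] at h1 hn1 hn3 hW
  rcases h1 with h2 | ⟨-, h2W⟩
  · rcases hW with ho1 | ho3
    · exact hn1 (h2.symm.trans ho1)
    · exact hn3 (h2.symm.trans ho3)
  · rcases h2W with h | h
    · exact hn1 h
    · exact hn3 h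

/-- `{a₂↮b}`-part of the glued `a₂↔b` event: `(a₂b ∪ Q')ᶜ = a₂bᶜ ∩ Q'ᶜ`, and `(a₂b ∪ Q') = a₂b ⊔ (a₂bᶜ ∩ Q')`. [folklore] -/
theorem gluedPair_a2glued_eq :
    ((openConn a₂ b ∪ (openConn a₂ a₁ ∩ openConn a₃ b ∪ openConn a₂ a₃ ∩ openConn a₁ b)) : Set (BondConfig (Fin n))) =
      openConn a₂ b ∪ ((openConn a₂ b)ᶜ ∩ (openConn a₂ a₁ ∩ openConn a₃ b ∪ openConn a₂ a₃ ∩ openConn a₁ b)) := by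
  ext ω; simp only [Set.mem_union, Set.mem_inter_iff, Set.mem_compl_iff]; tauto

/-- The two pieces of `gluedPair_a2glued_eq` are disjoint. [folklore] -/
theorem gluedPair_a2glued_disj :
    Disjoint (openConn a₂ b : Set (BondConfig (Fin n)))
      ((openConn a₂ b)ᶜ ∩ (openConn a₂ a₁ ∩ openConn a₃ b ∪ openConn a₂ a₃ ∩ openConn a₁ b)) := by
  rw [Set.disjoint_left]; intro ω h1 h2; exact h2.1 h1

/-- `Q'ᶜ ∩ a₂bᶜ = ((a₂a₁ ∪ a₂a₃) ∩ B_W)ᶜ ∩ a₂bᶜ`. [folklore] -/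
theorem gluedPair_Q_compl_eq :
    ((openConn a₂ b)ᶜ ∩ (openConn a₂ a₁ ∩ openConn a₃ b ∪ openConn a₂ a₃ ∩ openConn a₁ b)ᶜ : Set (BondConfig (Fin n))) =
      (openConn a₂ b)ᶜ ∩ ((openConn a₂ a₁ ∪ openConn a₂ a₃) ∩ (openConn a₁ b ∪ openConn a₃ b))ᶜ := by
  ext ω
  simp only [Set.mem_inter_iff, Set.mem_compl_iff, Set.mem_union, knThm2_mem_openConn]
  constructor
  · rintro ⟨hnb, hQ⟩
    refine ⟨hnb, ?_⟩
    rintro ⟨hW, hB⟩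
    rcases hW with h21 | h23
    · rcases hB with h1 | h3
      · exact hnb (h21.trans h1)
      · exact hQ (Or.inl ⟨h21, h3⟩)
    · rcases hB with h1 | h3
      · exact hQ (Or.inr ⟨h23, h1⟩)
      · exact hnb (h23.trans h3)
  · rintro ⟨hnb, hWB⟩
    refine ⟨hnb, ?_⟩
    rintro (⟨h21, h3⟩ | ⟨h23, h1⟩)
    · exact hWB ⟨Or.inl h21, Or.inr h3⟩
    · exact hWB ⟨Or.inr h23, Or.inl h1⟩

end SetIdentities

/-- `(a₁b ∪ a₃b)ᶜ ∖ OA = a₁bᶜ ∩ a₃bᶜ ∩ OAᶜ`. [folklore] -/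
theorem gluedPair_RW_eq (o b a₁ a₂ a₃ : Fin n) :
    ((openConn a₁ b ∪ openConn a₃ b)ᶜ \ (openConn o a₁ ∪ openConn o a₂ ∪ openConn o a₃) : Set (BondConfig (Fin n))) =
      (openConn a₁ b)ᶜ ∩ (openConn a₃ b)ᶜ ∩ (openConn o a₁ ∪ openConn o a₂ ∪ openConn o a₃)ᶜ := by
  ext ω; simp only [Set.mem_sdiff, Set.mem_compl_iff, Set.mem_union, Set.mem_inter_iff]; tauto

/-- The separation event of `gluedPair_weightedThm1` for `W = {a₁,a₃}`, `S' = {a₂}` is `N₂ = {a₂↮a₁} ∩ {a₂↮a₃}`. [folklore] -/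
theorem gluedPair_sep_pair_eq (a₁ a₂ a₃ : Fin n) :
    {ω : BondConfig (Fin n) | ∀ s ∈ ({a₁, a₃} : Finset (Fin n)), ∀ x ∈ ({a₂} : Finset (Fin n)), ¬ (openGraph ω).Reachable s x} =
      (openConn a₂ a₁)ᶜ ∩ (openConn a₂ a₃)ᶜ := by
  ext ω
  simp only [Set.mem_setOf_eq, Finset.mem_insert, Finset.mem_singleton, forall_eq_or_imp, forall_eq, Set.mem_inter_iff,
    Set.mem_compl_iff, knThm2_mem_openConn]
  constructor
  · rintro ⟨h1, h3⟩; exact ⟨fun h => h1 h.symm, fun h => h3 h.symm⟩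
  · rintro ⟨h1, h3⟩; exact ⟨fun h => h1 h.symm, fun h => h3 h.symm⟩

/-- `⋃_{s ∈ {a₁,a₃}} {s ↔ x} = {x ↔ a₁} ∪ {x ↔ a₃}` and `⋃_{s ∈ {a₂}} {s ↔ x} = {x ↔ a₂}` (up to the orientation used
in this file). [folklore] -/
theorem gluedPair_biUnion_pair_eq (x a₁ a₃ : Fin n) :
    (⋃ s ∈ ({a₁, a₃} : Finset (Fin n)), (openConn s x : Set (BondConfig (Fin n)))) = openConn x a₁ ∪ openConn x a₃ := by
  ext ω
  simp only [Set.mem_iUnion, Finset.mem_insert, Finset.mem_singleton, exists_prop, Set.mem_union, knThm2_mem_openConn]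
  constructor
  · rintro ⟨s, hs | hs, h⟩
    · subst hs; exact Or.inl h.symm
    · subst hs; exact Or.inr h.symm
  · rintro (h | h)
    · exact ⟨a₁, Or.inl rfl, h.symm⟩
    · exact ⟨a₃, Or.inr rfl, h.symm⟩

/-- `⋃_{s ∈ {a₂}} {s ↔ x} = {x ↔ a₂}`. [folklore] -/
theorem gluedPair_biUnion_single_eq (x a₂ : Fin n) :
    (⋃ s ∈ ({a₂} : Finset (Fin n)), (openConn s x : Set (BondConfig (Fin n)))) = openConn x a₂ := by
  ext ω
  simp only [Set.mem_iUnion, Finset.mem_singleton, exists_prop, exists_eq_left, knThm2_mem_openConn]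
  exact ⟨fun h => h.symm, fun h => h.symm⟩

end

end Summit.CriticalPhenomena.PercolationContinuityZ3.Theorems
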